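/-
Copyright: the b2b-balaban T⁴-continuum CRUX team, row NE7b OWNER lineage `t4-ne7b-p1` (gen 136). Project licence.
-/
import Summits.QuantumFields.BalabanUV.T4Continuum.Spine.NE7b.SupResidualFactorRegulated

/-!
# THE RESIDUAL IS AGAIN IN THE TWO-SIDED SECOND-ORDER CLASS — WITH CONSTANTS `(λ⁺, Λ⁺) = (λ_w + ½Λ_w, Λ_w + 2λ_w)` BEFORE RESCALING.
# The next single-block potential after extraction, `w⁺(ζ) := −r(ζ) = W(ψ₀+ζ) − W(ψ₀) − ⟨b_D,ζ⟩ − ½ζᵀK_Dζ` (`W = −log Z`), satisfies for ALL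
# `ζ, ζ′` the same two-sided second-order letters that the INPUT remainders `w_x` carried (`hwlo`, `hwup`):
#   `−λ⁺·Q(ζ′−ζ) ≤ w⁺(ζ′) − w⁺(ζ) − Dw⁺(ζ)(ζ′−ζ) ≤ ½Λ⁺·Q(ζ′−ζ)`,   `Dw⁺(ζ) = DW(ψ₀+ζ) − ⟨b_D,·⟩ − ζᵀK_D(·)`,   `Q = Σ_Y(·)²`,
# from (316)∕(318) at the base point `ψ₀ + ζ` and (388)'s matrix letters `−2λ_w ≤ K_D ≤ Λ_w` on the quadratic correction
# `½(ζ′ᵀKζ′ − ζᵀKζ) − ζᵀK(ζ′−ζ) = ½(ζ′−ζ)ᵀK(ζ′−ζ)`.  THE CLASS REPRODUCES; its constants ADD (`λ⁺ + ½Λ⁺ = 2(λ_w + ½Λ_w)`): without the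
# rescaling of (352)–(370) the class constant DOUBLES per step — the second-order twin of (374)'s located obstruction, now stated for the
# HONEST output object (row NE7b, node U5c; (316)∕(318)∕(320)∕(388)∕(391) BY NAME; [folklore])

Cell `pub-balaban`, sub-cell `t4`, spine estimate NE7b (`T4WeightBudget.RelWeightBound`; the cell's OWN estimate — NOT PRINTED in
[Bałaban 1983–89], NOT PROVED).  Crux-route work under `Spine/NE7b/` by the row OWNER (`t4-ne7b-p1` gen 136, file (394)) under FREEZE
(0)'s crux-prover clause, on this gen's SCOPING-d8 (β1)∕(β4) («is the class stable under the dressed step?»); NOTHING of Bałaban's is named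
as a Lean object, valued or asserted; no `T4Continuum/Support` leaf typed; no `def`, no notation (`K_D` WRITTEN OUT); zero `sorry`.  Imports
(BY NAME): the OWNER's (391) `…SupResidualFactorRegulated` (`quadratic_part_two_sided`) and through it (388) (`symmMatrix_isHermitian`),
(316) (`neg_log_step_upper_letter`), (318) (`neg_log_step_lower_letter`), (297) (`cellSum_eq_sum_biUnion`).

WHAT IS PROVED ([folklore]; `Y = ⋃_{p∈C} cell p`, `Z(ψ) = ∫e^{−Σ_Y w_x(ω_x+ψ_x)}dN(0,M⁻¹)`, `K = K_D(ψ₀)`):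
* §1 `quadratic_increment` (`K` symmetric ⟹ `ζ′ᵀKζ′ − ζᵀKζ − 2ζᵀK(ζ′−ζ) = (ζ′−ζ)ᵀK(ζ′−ζ)`), `neg_log_two_sided_at` ((316)∕(318) at the base
  point `ψ₀+ζ` towards `ψ₀+ζ′`, `Y`-form);
* §2 THE END **`residual_second_order_class`**: for ALL `ζ, ζ′`,
  `−(λ_w+½Λ_w)·Q(ζ′−ζ) ≤ w⁺(ζ′) − w⁺(ζ) − Dw⁺(ζ)(ζ′−ζ) ≤ ½(Λ_w+2λ_w)·Q(ζ′−ζ)` with `w⁺`, `Dw⁺` written out; §3 toy.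

HONEST (what this is NOT).  Global letters only: on the small-field ball the residual's second-order constants are `O(C₃·radius)` by the cubic
letter ((337b)∕(389)) — the successor's sharper ON-BALL class letter; the rescaling that must turn `(λ⁺, Λ⁺)` back into `(λ_w, Λ_w)`-size in
natural units is the RG proper and is NOT claimed; scalar skeleton ((A3), NC-NE7b-α UNRULED); nothing of Bałaban's asserted.  BY-NAME EFFECT ON
THE WALL: NONE.  NE7b NOT PRINTED ∕ NOT PROVED; spine PROVED 0∕9; rung (B)+1 — the programme's measures remain FINITE-torus statements; NOT the
mass gap, NOT Clay.  HONEST DEPENDENCY: continuum YM on T⁴ ⇐ BetaPertH ∧ nine spine estimates (0∕9 proved); BetaPertH ⇐ (D1) ∧ (D4) ∧ CAP+tail;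
G-an2-4 gates asym, D1 and NE2∕3∕4.
-/

set_option autoImplicit false
set_option maxSynthPendingDepth 2

noncomputable section

namespace Summit.QuantumFields.BalabanUV.T4Continuum.NE7b.SupResidualSecondOrderClass

open MeasureTheory ProbabilityTheory Finset Real Matrix
open scoped BigOperators
open SupResidualFactorRegulated (quadratic_part_two_sided)
open SupNextHessianMatrix (symmMatrix_isHermitian)
open SupEffectiveActionUpperLetter (neg_log_step_upper_letter)
open SupEffectiveActionLowerLetter (neg_log_step_lower_letter)
open SupSmallFieldGasReal (cellSum_eq_sum_biUnion)

variable {ι : Type} [Fintype ι] [DecidableEq ι] {V : Type*}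

/-! ## §1. The quadratic increment; the two-sided letters at a shifted base point -/

omit [DecidableEq ι] in
/-- **Quadratic increment for a symmetric matrix**: `ζ′ᵀKζ′ − ζᵀKζ − 2ζᵀK(ζ′−ζ) = (ζ′−ζ)ᵀK(ζ′−ζ)`. [folklore] -/
theorem quadratic_increment {K : Matrix ι ι ℝ} (hK : K.IsHermitian) (z z' : ι → ℝ) :
    z' ⬝ᵥ K *ᵥ z' - z ⬝ᵥ K *ᵥ z - 2 * (z ⬝ᵥ K *ᵥ (z' - z)) = (z' - z) ⬝ᵥ K *ᵥ (z' - z) := by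
  have hKt : Kᵀ = K := by
    have h := hK; rwa [Matrix.IsHermitian, conjTranspose_eq_transpose_of_trivial] at h
  have hsymm : ∀ u v : ι → ℝ, u ⬝ᵥ K *ᵥ v = v ⬝ᵥ K *ᵥ u := fun u v => by
    rw [dotProduct_mulVec, ← mulVec_transpose, hKt, dotProduct_comm]
  have h1 := hsymm z z'
  simp only [mulVec_sub, dotProduct_sub, sub_dotProduct]
  linarith

section Road

variable {cell : V → Finset ι} {w w' w'' : ι → ℝ → ℝ} {κ₀ κ₁ κ₂ τ δ θ : ℝ}

/-- **The two-sided second-order letters of `W = −log Z` at the base point `ψ₀ + ζ` towards `ψ₀ + ζ′`** ((316) upper, (318) lower, in the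
`Y`-form). [folklore] -/
theorem neg_log_two_sided_at {M : Matrix ι ι ℝ} {γop m lamw Λw : ℝ} (hM : M.PosDef)
    (hfl : ∀ z : ι → ℝ, m * ∑ i, z i ^ 2 ≤ z ⬝ᵥ (M *ᵥ z)) (hΓop : (γop • (1 : Matrix ι ι ℝ) - M⁻¹).PosSemidef)
    (hdisj : ∀ p q, p ≠ q → Disjoint (cell p) (cell q)) (hw' : ∀ x t, HasDerivAt (w x) (w' x t) t) (hw'm : ∀ x, Measurable (w' x))
    (hκ₀ : 0 ≤ κ₀) (hκ₁ : 0 ≤ κ₁) (hτ : 0 < τ) (hδ : 0 < δ) (hθ0 : 0 < θ) (hθ1 : θ < 1) (hκθ : (2 * κ₀ * (1 + τ) + 4 * δ) * γop ≤ θ)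
    (hκθ₆ : 6 * κ₀ * (1 + τ) * γop ≤ θ) (hstab : ∀ x, ∀ t : ℝ, -(κ₀ * t ^ 2) ≤ w x t) (hquad : ∀ x, ∀ t : ℝ, w x t ≤ κ₀ * t ^ 2)
    (hw'b : ∀ x t, |w' x t| ≤ κ₁ * |t|) (hlamw : 0 ≤ lamw)
    (hwlo : ∀ u (a b : ℝ), w u a + w' u a * (b - a) - lamw / 2 * (b - a) ^ 2 ≤ w u b)
    (hwup : ∀ x (a b : ℝ), w x b ≤ w x a + w' x a * (b - a) + Λw / 2 * (b - a) ^ 2) (hm : 2 * lamw ≤ m) (C : Finset V)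
    (ψ₀ ζ ζ' : EuclideanSpace ℝ ι) :
    -Real.log (∫ ω : EuclideanSpace ℝ ι, exp (-(∑ x ∈ C.biUnion cell, w x (ω x + (ψ₀ x + ζ' x)))) ∂(multivariateGaussian 0 M⁻¹)) ≤
        -Real.log (∫ ω : EuclideanSpace ℝ ι, exp (-(∑ x ∈ C.biUnion cell, w x (ω x + (ψ₀ x + ζ x)))) ∂(multivariateGaussian 0 M⁻¹)) +
          fderiv ℝ (fun φ : EuclideanSpace ℝ ι =>
            -Real.log (∫ ω : EuclideanSpace ℝ ι, exp (-(∑ x ∈ C.biUnion cell, w x (ω x + φ x))) ∂(multivariateGaussian 0 M⁻¹))) (ψ₀ + ζ) (ζ' - ζ) +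
          Λw / 2 * (∑ x ∈ C.biUnion cell, (ζ' x - ζ x) ^ 2) ∧
      -Real.log (∫ ω : EuclideanSpace ℝ ι, exp (-(∑ x ∈ C.biUnion cell, w x (ω x + (ψ₀ x + ζ x)))) ∂(multivariateGaussian 0 M⁻¹)) +
          fderiv ℝ (fun φ : EuclideanSpace ℝ ι =>
            -Real.log (∫ ω : EuclideanSpace ℝ ι, exp (-(∑ x ∈ C.biUnion cell, w x (ω x + φ x))) ∂(multivariateGaussian 0 M⁻¹))) (ψ₀ + ζ) (ζ' - ζ) -
          lamw * (∑ x ∈ C.biUnion cell, (ζ' x - ζ x) ^ 2) ≤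
        -Real.log (∫ ω : EuclideanSpace ℝ ι, exp (-(∑ x ∈ C.biUnion cell, w x (ω x + (ψ₀ x + ζ' x)))) ∂(multivariateGaussian 0 M⁻¹)) := by
  have hΓ : (M⁻¹).PosSemidef := hM.inv.posSemidef
  have hup := neg_log_step_upper_letter hΓ hΓop hdisj hw' hw'm hκ₀ hκ₁ hτ hδ hθ0 hθ1 hκθ hκθ₆ hstab hquad hw'b hwup C (ψ₀ + ζ) (ψ₀ + ζ')
  have hlo := neg_log_step_lower_letter hM hfl hΓop hdisj hw' hw'm hκ₀ hκ₁ hτ hδ hθ0 hθ1 hκθ hstab hw'b hlamw hwlo hm C (ψ₀ + ζ) (ψ₀ + ζ')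
  simp only [cellSum_eq_sum_biUnion cell hdisj C, WithLp.ofLp_add, Pi.add_apply, add_sub_add_left_eq_sub] at hup hlo
  exact ⟨hup, hlo⟩

/-! ## §2. THE END: the residual reproduces the two-sided second-order class -/

/-- **THE RESIDUAL IS IN THE TWO-SIDED SECOND-ORDER CLASS WITH `(λ⁺, Λ⁺) = (λ_w + ½Λ_w, Λ_w + 2λ_w)`.**  Under (388)∕(391)'s hypotheses,
for ALL `ζ, ζ′`: writing `W = −log Z`, `K = K_D(ψ₀)` and `w⁺(ζ) = W(ψ₀+ζ) − W(ψ₀) − ⟨b_D,ζ⟩ − ½ζᵀKζ`, the increment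
`w⁺(ζ′) − w⁺(ζ) − Dw⁺(ζ)(ζ′−ζ)` (in which `W(ψ₀)` and the `⟨b_D,·⟩` parts cancel identically, `Dw⁺(ζ)(ζ′−ζ) = DW(ψ₀+ζ)(ζ′−ζ) − ⟨b_D,ζ′−ζ⟩ −
ζᵀK(ζ′−ζ)`) equals `[W(ψ₀+ζ′) − W(ψ₀+ζ) − ½(ζ′ᵀKζ′ − ζᵀKζ)] − [DW(ψ₀+ζ)(ζ′−ζ) − ζᵀK(ζ′−ζ)]` and satisfies
`−(λ_w+½Λ_w)·Q(ζ′−ζ) ≤ · ≤ ½(Λ_w+2λ_w)·Q(ζ′−ζ)`, `Q = Σ_Y(·)²`. [folklore] -/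
theorem residual_second_order_class {M : Matrix ι ι ℝ} {γop m lamw Λw : ℝ} (hM : M.PosDef)
    (hfl : ∀ z : ι → ℝ, m * ∑ i, z i ^ 2 ≤ z ⬝ᵥ (M *ᵥ z)) (hΓop : (γop • (1 : Matrix ι ι ℝ) - M⁻¹).PosSemidef)
    (hdisj : ∀ p q, p ≠ q → Disjoint (cell p) (cell q)) (hw' : ∀ x t, HasDerivAt (w x) (w' x t) t)
    (hw'' : ∀ x t, HasDerivAt (w' x) (w'' x t) t) (hw'm : ∀ x, Measurable (w' x)) (hw''m : ∀ x, Measurable (w'' x))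
    (hκ₀ : 0 ≤ κ₀) (hκ₁ : 0 ≤ κ₁) (hτ : 0 < τ) (hδ : 0 < δ) (hθ0 : 0 < θ) (hθ1 : θ < 1) (hκθ : (2 * κ₀ * (1 + τ) + 4 * δ) * γop ≤ θ)
    (hκθ₆ : 6 * κ₀ * (1 + τ) * γop ≤ θ) (hstab : ∀ x, ∀ t : ℝ, -(κ₀ * t ^ 2) ≤ w x t) (hquad : ∀ x, ∀ t : ℝ, w x t ≤ κ₀ * t ^ 2)
    (hw'b : ∀ x t, |w' x t| ≤ κ₁ * |t|) (hw''b : ∀ x t, |w'' x t| ≤ κ₂) (hlamw : 0 ≤ lamw)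
    (hwlo : ∀ u (a b : ℝ), w u a + w' u a * (b - a) - lamw / 2 * (b - a) ^ 2 ≤ w u b)
    (hwup : ∀ x (a b : ℝ), w x b ≤ w x a + w' x a * (b - a) + Λw / 2 * (b - a) ^ 2) (hm : 2 * lamw ≤ m) (C : Finset V)
    (ψ₀ ζ ζ' : EuclideanSpace ℝ ι) :
    -((lamw + Λw / 2) * (∑ x ∈ C.biUnion cell, (ζ' x - ζ x) ^ 2)) ≤
        (-Real.log (∫ ω : EuclideanSpace ℝ ι, exp (-(∑ x ∈ C.biUnion cell, w x (ω x + (ψ₀ x + ζ' x)))) ∂(multivariateGaussian 0 M⁻¹)) -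
              -Real.log (∫ ω : EuclideanSpace ℝ ι, exp (-(∑ x ∈ C.biUnion cell, w x (ω x + (ψ₀ x + ζ x)))) ∂(multivariateGaussian 0 M⁻¹)) -
            (((WithLp.ofLp ζ') ⬝ᵥ (Matrix.of fun x y : ι =>
      ((((∫ ω : EuclideanSpace ℝ ι, exp (-(∑ p ∈ C, ∑ x ∈ cell p, w x (ω x + ψ₀ x))) ∂(multivariateGaussian 0 M⁻¹))⁻¹ •
          (∫ ω : EuclideanSpace ℝ ι, exp (-(∑ p ∈ C, ∑ x ∈ cell p, w x (ω x + ψ₀ x))) •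
            ((∑ p ∈ C, ∑ x ∈ cell p, (w'' x (ω x + ψ₀ x)) • ((EuclideanSpace.proj x : EuclideanSpace ℝ ι →L[ℝ] ℝ).smulRight
                (EuclideanSpace.proj x : EuclideanSpace ℝ ι →L[ℝ] ℝ))) -
              (∑ p ∈ C, ∑ x ∈ cell p, (w' x (ω x + ψ₀ x)) • (EuclideanSpace.proj x : EuclideanSpace ℝ ι →L[ℝ] ℝ)).smulRight
                (∑ p ∈ C, ∑ x ∈ cell p, (w' x (ω x + ψ₀ x)) • (EuclideanSpace.proj x : EuclideanSpace ℝ ι →L[ℝ] ℝ)))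
            ∂(multivariateGaussian 0 M⁻¹)) +
        (((∫ ω : EuclideanSpace ℝ ι, exp (-(∑ p ∈ C, ∑ x ∈ cell p, w x (ω x + ψ₀ x))) ∂(multivariateGaussian 0 M⁻¹)) ^ 2)⁻¹ •
          ∫ ω : EuclideanSpace ℝ ι, exp (-(∑ p ∈ C, ∑ x ∈ cell p, w x (ω x + ψ₀ x))) •
            (∑ p ∈ C, ∑ x ∈ cell p, (w' x (ω x + ψ₀ x)) • (EuclideanSpace.proj x : EuclideanSpace ℝ ι →L[ℝ] ℝ))
            ∂(multivariateGaussian 0 M⁻¹)).smulRight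
          (∫ ω : EuclideanSpace ℝ ι, exp (-(∑ p ∈ C, ∑ x ∈ cell p, w x (ω x + ψ₀ x))) •
            (∑ p ∈ C, ∑ x ∈ cell p, (w' x (ω x + ψ₀ x)) • (EuclideanSpace.proj x : EuclideanSpace ℝ ι →L[ℝ] ℝ))
            ∂(multivariateGaussian 0 M⁻¹)))
          (EuclideanSpace.single x (1 : ℝ)) (EuclideanSpace.single y (1 : ℝ)) +
        ((∫ ω : EuclideanSpace ℝ ι, exp (-(∑ p ∈ C, ∑ x ∈ cell p, w x (ω x + ψ₀ x))) ∂(multivariateGaussian 0 M⁻¹))⁻¹ •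
          (∫ ω : EuclideanSpace ℝ ι, exp (-(∑ p ∈ C, ∑ x ∈ cell p, w x (ω x + ψ₀ x))) •
            ((∑ p ∈ C, ∑ x ∈ cell p, (w'' x (ω x + ψ₀ x)) • ((EuclideanSpace.proj x : EuclideanSpace ℝ ι →L[ℝ] ℝ).smulRight
                (EuclideanSpace.proj x : EuclideanSpace ℝ ι →L[ℝ] ℝ))) -
              (∑ p ∈ C, ∑ x ∈ cell p, (w' x (ω x + ψ₀ x)) • (EuclideanSpace.proj x : EuclideanSpace ℝ ι →L[ℝ] ℝ)).smulRight
                (∑ p ∈ C, ∑ x ∈ cell p, (w' x (ω x + ψ₀ x)) • (EuclideanSpace.proj x : EuclideanSpace ℝ ι →L[ℝ] ℝ)))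
            ∂(multivariateGaussian 0 M⁻¹)) +
        (((∫ ω : EuclideanSpace ℝ ι, exp (-(∑ p ∈ C, ∑ x ∈ cell p, w x (ω x + ψ₀ x))) ∂(multivariateGaussian 0 M⁻¹)) ^ 2)⁻¹ •
          ∫ ω : EuclideanSpace ℝ ι, exp (-(∑ p ∈ C, ∑ x ∈ cell p, w x (ω x + ψ₀ x))) •
            (∑ p ∈ C, ∑ x ∈ cell p, (w' x (ω x + ψ₀ x)) • (EuclideanSpace.proj x : EuclideanSpace ℝ ι →L[ℝ] ℝ))
            ∂(multivariateGaussian 0 M⁻¹)).smulRight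
          (∫ ω : EuclideanSpace ℝ ι, exp (-(∑ p ∈ C, ∑ x ∈ cell p, w x (ω x + ψ₀ x))) •
            (∑ p ∈ C, ∑ x ∈ cell p, (w' x (ω x + ψ₀ x)) • (EuclideanSpace.proj x : EuclideanSpace ℝ ι →L[ℝ] ℝ))
            ∂(multivariateGaussian 0 M⁻¹)))
          (EuclideanSpace.single y (1 : ℝ)) (EuclideanSpace.single x (1 : ℝ))) / 2)) *ᵥ (WithLp.ofLp ζ')) - ((WithLp.ofLp ζ) ⬝ᵥ (Matrix.of fun x y : ι =>
      ((((∫ ω : EuclideanSpace ℝ ι, exp (-(∑ p ∈ C, ∑ x ∈ cell p, w x (ω x + ψ₀ x))) ∂(multivariateGaussian 0 M⁻¹))⁻¹ •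
          (∫ ω : EuclideanSpace ℝ ι, exp (-(∑ p ∈ C, ∑ x ∈ cell p, w x (ω x + ψ₀ x))) •
            ((∑ p ∈ C, ∑ x ∈ cell p, (w'' x (ω x + ψ₀ x)) • ((EuclideanSpace.proj x : EuclideanSpace ℝ ι →L[ℝ] ℝ).smulRight
                (EuclideanSpace.proj x : EuclideanSpace ℝ ι →L[ℝ] ℝ))) -
              (∑ p ∈ C, ∑ x ∈ cell p, (w' x (ω x + ψ₀ x)) • (EuclideanSpace.proj x : EuclideanSpace ℝ ι →L[ℝ] ℝ)).smulRight
                (∑ p ∈ C, ∑ x ∈ cell p, (w' x (ω x + ψ₀ x)) • (EuclideanSpace.proj x : EuclideanSpace ℝ ι →L[ℝ] ℝ)))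
            ∂(multivariateGaussian 0 M⁻¹)) +
        (((∫ ω : EuclideanSpace ℝ ι, exp (-(∑ p ∈ C, ∑ x ∈ cell p, w x (ω x + ψ₀ x))) ∂(multivariateGaussian 0 M⁻¹)) ^ 2)⁻¹ •
          ∫ ω : EuclideanSpace ℝ ι, exp (-(∑ p ∈ C, ∑ x ∈ cell p, w x (ω x + ψ₀ x))) •
            (∑ p ∈ C, ∑ x ∈ cell p, (w' x (ω x + ψ₀ x)) • (EuclideanSpace.proj x : EuclideanSpace ℝ ι →L[ℝ] ℝ))
            ∂(multivariateGaussian 0 M⁻¹)).smulRight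
          (∫ ω : EuclideanSpace ℝ ι, exp (-(∑ p ∈ C, ∑ x ∈ cell p, w x (ω x + ψ₀ x))) •
            (∑ p ∈ C, ∑ x ∈ cell p, (w' x (ω x + ψ₀ x)) • (EuclideanSpace.proj x : EuclideanSpace ℝ ι →L[ℝ] ℝ))
            ∂(multivariateGaussian 0 M⁻¹)))
          (EuclideanSpace.single x (1 : ℝ)) (EuclideanSpace.single y (1 : ℝ)) +
        ((∫ ω : EuclideanSpace ℝ ι, exp (-(∑ p ∈ C, ∑ x ∈ cell p, w x (ω x + ψ₀ x))) ∂(multivariateGaussian 0 M⁻¹))⁻¹ •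
          (∫ ω : EuclideanSpace ℝ ι, exp (-(∑ p ∈ C, ∑ x ∈ cell p, w x (ω x + ψ₀ x))) •
            ((∑ p ∈ C, ∑ x ∈ cell p, (w'' x (ω x + ψ₀ x)) • ((EuclideanSpace.proj x : EuclideanSpace ℝ ι →L[ℝ] ℝ).smulRight
                (EuclideanSpace.proj x : EuclideanSpace ℝ ι →L[ℝ] ℝ))) -
              (∑ p ∈ C, ∑ x ∈ cell p, (w' x (ω x + ψ₀ x)) • (EuclideanSpace.proj x : EuclideanSpace ℝ ι →L[ℝ] ℝ)).smulRight
                (∑ p ∈ C, ∑ x ∈ cell p, (w' x (ω x + ψ₀ x)) • (EuclideanSpace.proj x : EuclideanSpace ℝ ι →L[ℝ] ℝ)))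
            ∂(multivariateGaussian 0 M⁻¹)) +
        (((∫ ω : EuclideanSpace ℝ ι, exp (-(∑ p ∈ C, ∑ x ∈ cell p, w x (ω x + ψ₀ x))) ∂(multivariateGaussian 0 M⁻¹)) ^ 2)⁻¹ •
          ∫ ω : EuclideanSpace ℝ ι, exp (-(∑ p ∈ C, ∑ x ∈ cell p, w x (ω x + ψ₀ x))) •
            (∑ p ∈ C, ∑ x ∈ cell p, (w' x (ω x + ψ₀ x)) • (EuclideanSpace.proj x : EuclideanSpace ℝ ι →L[ℝ] ℝ))
            ∂(multivariateGaussian 0 M⁻¹)).smulRight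
          (∫ ω : EuclideanSpace ℝ ι, exp (-(∑ p ∈ C, ∑ x ∈ cell p, w x (ω x + ψ₀ x))) •
            (∑ p ∈ C, ∑ x ∈ cell p, (w' x (ω x + ψ₀ x)) • (EuclideanSpace.proj x : EuclideanSpace ℝ ι →L[ℝ] ℝ))
            ∂(multivariateGaussian 0 M⁻¹)))
          (EuclideanSpace.single y (1 : ℝ)) (EuclideanSpace.single x (1 : ℝ))) / 2)) *ᵥ (WithLp.ofLp ζ))) / 2) -
          (fderiv ℝ (fun φ : EuclideanSpace ℝ ι =>
            -Real.log (∫ ω : EuclideanSpace ℝ ι, exp (-(∑ x ∈ C.biUnion cell, w x (ω x + φ x))) ∂(multivariateGaussian 0 M⁻¹))) (ψ₀ + ζ) (ζ' - ζ) -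
            ((WithLp.ofLp ζ) ⬝ᵥ (Matrix.of fun x y : ι =>
      ((((∫ ω : EuclideanSpace ℝ ι, exp (-(∑ p ∈ C, ∑ x ∈ cell p, w x (ω x + ψ₀ x))) ∂(multivariateGaussian 0 M⁻¹))⁻¹ •
          (∫ ω : EuclideanSpace ℝ ι, exp (-(∑ p ∈ C, ∑ x ∈ cell p, w x (ω x + ψ₀ x))) •
            ((∑ p ∈ C, ∑ x ∈ cell p, (w'' x (ω x + ψ₀ x)) • ((EuclideanSpace.proj x : EuclideanSpace ℝ ι →L[ℝ] ℝ).smulRight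
                (EuclideanSpace.proj x : EuclideanSpace ℝ ι →L[ℝ] ℝ))) -
              (∑ p ∈ C, ∑ x ∈ cell p, (w' x (ω x + ψ₀ x)) • (EuclideanSpace.proj x : EuclideanSpace ℝ ι →L[ℝ] ℝ)).smulRight
                (∑ p ∈ C, ∑ x ∈ cell p, (w' x (ω x + ψ₀ x)) • (EuclideanSpace.proj x : EuclideanSpace ℝ ι →L[ℝ] ℝ)))
            ∂(multivariateGaussian 0 M⁻¹)) +
        (((∫ ω : EuclideanSpace ℝ ι, exp (-(∑ p ∈ C, ∑ x ∈ cell p, w x (ω x + ψ₀ x))) ∂(multivariateGaussian 0 M⁻¹)) ^ 2)⁻¹ •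
          ∫ ω : EuclideanSpace ℝ ι, exp (-(∑ p ∈ C, ∑ x ∈ cell p, w x (ω x + ψ₀ x))) •
            (∑ p ∈ C, ∑ x ∈ cell p, (w' x (ω x + ψ₀ x)) • (EuclideanSpace.proj x : EuclideanSpace ℝ ι →L[ℝ] ℝ))
            ∂(multivariateGaussian 0 M⁻¹)).smulRight
          (∫ ω : EuclideanSpace ℝ ι, exp (-(∑ p ∈ C, ∑ x ∈ cell p, w x (ω x + ψ₀ x))) •
            (∑ p ∈ C, ∑ x ∈ cell p, (w' x (ω x + ψ₀ x)) • (EuclideanSpace.proj x : EuclideanSpace ℝ ι →L[ℝ] ℝ))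
            ∂(multivariateGaussian 0 M⁻¹)))
          (EuclideanSpace.single x (1 : ℝ)) (EuclideanSpace.single y (1 : ℝ)) +
        ((∫ ω : EuclideanSpace ℝ ι, exp (-(∑ p ∈ C, ∑ x ∈ cell p, w x (ω x + ψ₀ x))) ∂(multivariateGaussian 0 M⁻¹))⁻¹ •
          (∫ ω : EuclideanSpace ℝ ι, exp (-(∑ p ∈ C, ∑ x ∈ cell p, w x (ω x + ψ₀ x))) •
            ((∑ p ∈ C, ∑ x ∈ cell p, (w'' x (ω x + ψ₀ x)) • ((EuclideanSpace.proj x : EuclideanSpace ℝ ι →L[ℝ] ℝ).smulRight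
                (EuclideanSpace.proj x : EuclideanSpace ℝ ι →L[ℝ] ℝ))) -
              (∑ p ∈ C, ∑ x ∈ cell p, (w' x (ω x + ψ₀ x)) • (EuclideanSpace.proj x : EuclideanSpace ℝ ι →L[ℝ] ℝ)).smulRight
                (∑ p ∈ C, ∑ x ∈ cell p, (w' x (ω x + ψ₀ x)) • (EuclideanSpace.proj x : EuclideanSpace ℝ ι →L[ℝ] ℝ)))
            ∂(multivariateGaussian 0 M⁻¹)) +
        (((∫ ω : EuclideanSpace ℝ ι, exp (-(∑ p ∈ C, ∑ x ∈ cell p, w x (ω x + ψ₀ x))) ∂(multivariateGaussian 0 M⁻¹)) ^ 2)⁻¹ •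
          ∫ ω : EuclideanSpace ℝ ι, exp (-(∑ p ∈ C, ∑ x ∈ cell p, w x (ω x + ψ₀ x))) •
            (∑ p ∈ C, ∑ x ∈ cell p, (w' x (ω x + ψ₀ x)) • (EuclideanSpace.proj x : EuclideanSpace ℝ ι →L[ℝ] ℝ))
            ∂(multivariateGaussian 0 M⁻¹)).smulRight
          (∫ ω : EuclideanSpace ℝ ι, exp (-(∑ p ∈ C, ∑ x ∈ cell p, w x (ω x + ψ₀ x))) •
            (∑ p ∈ C, ∑ x ∈ cell p, (w' x (ω x + ψ₀ x)) • (EuclideanSpace.proj x : EuclideanSpace ℝ ι →L[ℝ] ℝ))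
            ∂(multivariateGaussian 0 M⁻¹)))
          (EuclideanSpace.single y (1 : ℝ)) (EuclideanSpace.single x (1 : ℝ))) / 2)) *ᵥ (WithLp.ofLp (ζ' - ζ)))) ∧
      (-Real.log (∫ ω : EuclideanSpace ℝ ι, exp (-(∑ x ∈ C.biUnion cell, w x (ω x + (ψ₀ x + ζ' x)))) ∂(multivariateGaussian 0 M⁻¹)) -
              -Real.log (∫ ω : EuclideanSpace ℝ ι, exp (-(∑ x ∈ C.biUnion cell, w x (ω x + (ψ₀ x + ζ x)))) ∂(multivariateGaussian 0 M⁻¹)) -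
            (((WithLp.ofLp ζ') ⬝ᵥ (Matrix.of fun x y : ι =>
      ((((∫ ω : EuclideanSpace ℝ ι, exp (-(∑ p ∈ C, ∑ x ∈ cell p, w x (ω x + ψ₀ x))) ∂(multivariateGaussian 0 M⁻¹))⁻¹ •
          (∫ ω : EuclideanSpace ℝ ι, exp (-(∑ p ∈ C, ∑ x ∈ cell p, w x (ω x + ψ₀ x))) •
            ((∑ p ∈ C, ∑ x ∈ cell p, (w'' x (ω x + ψ₀ x)) • ((EuclideanSpace.proj x : EuclideanSpace ℝ ι →L[ℝ] ℝ).smulRight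
                (EuclideanSpace.proj x : EuclideanSpace ℝ ι →L[ℝ] ℝ))) -
              (∑ p ∈ C, ∑ x ∈ cell p, (w' x (ω x + ψ₀ x)) • (EuclideanSpace.proj x : EuclideanSpace ℝ ι →L[ℝ] ℝ)).smulRight
                (∑ p ∈ C, ∑ x ∈ cell p, (w' x (ω x + ψ₀ x)) • (EuclideanSpace.proj x : EuclideanSpace ℝ ι →L[ℝ] ℝ)))
            ∂(multivariateGaussian 0 M⁻¹)) +
        (((∫ ω : EuclideanSpace ℝ ι, exp (-(∑ p ∈ C, ∑ x ∈ cell p, w x (ω x + ψ₀ x))) ∂(multivariateGaussian 0 M⁻¹)) ^ 2)⁻¹ •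
          ∫ ω : EuclideanSpace ℝ ι, exp (-(∑ p ∈ C, ∑ x ∈ cell p, w x (ω x + ψ₀ x))) •
            (∑ p ∈ C, ∑ x ∈ cell p, (w' x (ω x + ψ₀ x)) • (EuclideanSpace.proj x : EuclideanSpace ℝ ι →L[ℝ] ℝ))
            ∂(multivariateGaussian 0 M⁻¹)).smulRight
          (∫ ω : EuclideanSpace ℝ ι, exp (-(∑ p ∈ C, ∑ x ∈ cell p, w x (ω x + ψ₀ x))) •
            (∑ p ∈ C, ∑ x ∈ cell p, (w' x (ω x + ψ₀ x)) • (EuclideanSpace.proj x : EuclideanSpace ℝ ι →L[ℝ] ℝ))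
            ∂(multivariateGaussian 0 M⁻¹)))
          (EuclideanSpace.single x (1 : ℝ)) (EuclideanSpace.single y (1 : ℝ)) +
        ((∫ ω : EuclideanSpace ℝ ι, exp (-(∑ p ∈ C, ∑ x ∈ cell p, w x (ω x + ψ₀ x))) ∂(multivariateGaussian 0 M⁻¹))⁻¹ •
          (∫ ω : EuclideanSpace ℝ ι, exp (-(∑ p ∈ C, ∑ x ∈ cell p, w x (ω x + ψ₀ x))) •
            ((∑ p ∈ C, ∑ x ∈ cell p, (w'' x (ω x + ψ₀ x)) • ((EuclideanSpace.proj x : EuclideanSpace ℝ ι →L[ℝ] ℝ).smulRight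
                (EuclideanSpace.proj x : EuclideanSpace ℝ ι →L[ℝ] ℝ))) -
              (∑ p ∈ C, ∑ x ∈ cell p, (w' x (ω x + ψ₀ x)) • (EuclideanSpace.proj x : EuclideanSpace ℝ ι →L[ℝ] ℝ)).smulRight
                (∑ p ∈ C, ∑ x ∈ cell p, (w' x (ω x + ψ₀ x)) • (EuclideanSpace.proj x : EuclideanSpace ℝ ι →L[ℝ] ℝ)))
            ∂(multivariateGaussian 0 M⁻¹)) +
        (((∫ ω : EuclideanSpace ℝ ι, exp (-(∑ p ∈ C, ∑ x ∈ cell p, w x (ω x + ψ₀ x))) ∂(multivariateGaussian 0 M⁻¹)) ^ 2)⁻¹ •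
          ∫ ω : EuclideanSpace ℝ ι, exp (-(∑ p ∈ C, ∑ x ∈ cell p, w x (ω x + ψ₀ x))) •
            (∑ p ∈ C, ∑ x ∈ cell p, (w' x (ω x + ψ₀ x)) • (EuclideanSpace.proj x : EuclideanSpace ℝ ι →L[ℝ] ℝ))
            ∂(multivariateGaussian 0 M⁻¹)).smulRight
          (∫ ω : EuclideanSpace ℝ ι, exp (-(∑ p ∈ C, ∑ x ∈ cell p, w x (ω x + ψ₀ x))) •
            (∑ p ∈ C, ∑ x ∈ cell p, (w' x (ω x + ψ₀ x)) • (EuclideanSpace.proj x : EuclideanSpace ℝ ι →L[ℝ] ℝ))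
            ∂(multivariateGaussian 0 M⁻¹)))
          (EuclideanSpace.single y (1 : ℝ)) (EuclideanSpace.single x (1 : ℝ))) / 2)) *ᵥ (WithLp.ofLp ζ')) - ((WithLp.ofLp ζ) ⬝ᵥ (Matrix.of fun x y : ι =>
      ((((∫ ω : EuclideanSpace ℝ ι, exp (-(∑ p ∈ C, ∑ x ∈ cell p, w x (ω x + ψ₀ x))) ∂(multivariateGaussian 0 M⁻¹))⁻¹ •
          (∫ ω : EuclideanSpace ℝ ι, exp (-(∑ p ∈ C, ∑ x ∈ cell p, w x (ω x + ψ₀ x))) •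
            ((∑ p ∈ C, ∑ x ∈ cell p, (w'' x (ω x + ψ₀ x)) • ((EuclideanSpace.proj x : EuclideanSpace ℝ ι →L[ℝ] ℝ).smulRight
                (EuclideanSpace.proj x : EuclideanSpace ℝ ι →L[ℝ] ℝ))) -
              (∑ p ∈ C, ∑ x ∈ cell p, (w' x (ω x + ψ₀ x)) • (EuclideanSpace.proj x : EuclideanSpace ℝ ι →L[ℝ] ℝ)).smulRight
                (∑ p ∈ C, ∑ x ∈ cell p, (w' x (ω x + ψ₀ x)) • (EuclideanSpace.proj x : EuclideanSpace ℝ ι →L[ℝ] ℝ)))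
            ∂(multivariateGaussian 0 M⁻¹)) +
        (((∫ ω : EuclideanSpace ℝ ι, exp (-(∑ p ∈ C, ∑ x ∈ cell p, w x (ω x + ψ₀ x))) ∂(multivariateGaussian 0 M⁻¹)) ^ 2)⁻¹ •
          ∫ ω : EuclideanSpace ℝ ι, exp (-(∑ p ∈ C, ∑ x ∈ cell p, w x (ω x + ψ₀ x))) •
            (∑ p ∈ C, ∑ x ∈ cell p, (w' x (ω x + ψ₀ x)) • (EuclideanSpace.proj x : EuclideanSpace ℝ ι →L[ℝ] ℝ))
            ∂(multivariateGaussian 0 M⁻¹)).smulRight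
          (∫ ω : EuclideanSpace ℝ ι, exp (-(∑ p ∈ C, ∑ x ∈ cell p, w x (ω x + ψ₀ x))) •
            (∑ p ∈ C, ∑ x ∈ cell p, (w' x (ω x + ψ₀ x)) • (EuclideanSpace.proj x : EuclideanSpace ℝ ι →L[ℝ] ℝ))
            ∂(multivariateGaussian 0 M⁻¹)))
          (EuclideanSpace.single x (1 : ℝ)) (EuclideanSpace.single y (1 : ℝ)) +
        ((∫ ω : EuclideanSpace ℝ ι, exp (-(∑ p ∈ C, ∑ x ∈ cell p, w x (ω x + ψ₀ x))) ∂(multivariateGaussian 0 M⁻¹))⁻¹ •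
          (∫ ω : EuclideanSpace ℝ ι, exp (-(∑ p ∈ C, ∑ x ∈ cell p, w x (ω x + ψ₀ x))) •
            ((∑ p ∈ C, ∑ x ∈ cell p, (w'' x (ω x + ψ₀ x)) • ((EuclideanSpace.proj x : EuclideanSpace ℝ ι →L[ℝ] ℝ).smulRight
                (EuclideanSpace.proj x : EuclideanSpace ℝ ι →L[ℝ] ℝ))) -
              (∑ p ∈ C, ∑ x ∈ cell p, (w' x (ω x + ψ₀ x)) • (EuclideanSpace.proj x : EuclideanSpace ℝ ι →L[ℝ] ℝ)).smulRight
                (∑ p ∈ C, ∑ x ∈ cell p, (w' x (ω x + ψ₀ x)) • (EuclideanSpace.proj x : EuclideanSpace ℝ ι →L[ℝ] ℝ)))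
            ∂(multivariateGaussian 0 M⁻¹)) +
        (((∫ ω : EuclideanSpace ℝ ι, exp (-(∑ p ∈ C, ∑ x ∈ cell p, w x (ω x + ψ₀ x))) ∂(multivariateGaussian 0 M⁻¹)) ^ 2)⁻¹ •
          ∫ ω : EuclideanSpace ℝ ι, exp (-(∑ p ∈ C, ∑ x ∈ cell p, w x (ω x + ψ₀ x))) •
            (∑ p ∈ C, ∑ x ∈ cell p, (w' x (ω x + ψ₀ x)) • (EuclideanSpace.proj x : EuclideanSpace ℝ ι →L[ℝ] ℝ))
            ∂(multivariateGaussian 0 M⁻¹)).smulRight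
          (∫ ω : EuclideanSpace ℝ ι, exp (-(∑ p ∈ C, ∑ x ∈ cell p, w x (ω x + ψ₀ x))) •
            (∑ p ∈ C, ∑ x ∈ cell p, (w' x (ω x + ψ₀ x)) • (EuclideanSpace.proj x : EuclideanSpace ℝ ι →L[ℝ] ℝ))
            ∂(multivariateGaussian 0 M⁻¹)))
          (EuclideanSpace.single y (1 : ℝ)) (EuclideanSpace.single x (1 : ℝ))) / 2)) *ᵥ (WithLp.ofLp ζ))) / 2) -
          (fderiv ℝ (fun φ : EuclideanSpace ℝ ι =>
            -Real.log (∫ ω : EuclideanSpace ℝ ι, exp (-(∑ x ∈ C.biUnion cell, w x (ω x + φ x))) ∂(multivariateGaussian 0 M⁻¹))) (ψ₀ + ζ) (ζ' - ζ) -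
            ((WithLp.ofLp ζ) ⬝ᵥ (Matrix.of fun x y : ι =>
      ((((∫ ω : EuclideanSpace ℝ ι, exp (-(∑ p ∈ C, ∑ x ∈ cell p, w x (ω x + ψ₀ x))) ∂(multivariateGaussian 0 M⁻¹))⁻¹ •
          (∫ ω : EuclideanSpace ℝ ι, exp (-(∑ p ∈ C, ∑ x ∈ cell p, w x (ω x + ψ₀ x))) •
            ((∑ p ∈ C, ∑ x ∈ cell p, (w'' x (ω x + ψ₀ x)) • ((EuclideanSpace.proj x : EuclideanSpace ℝ ι →L[ℝ] ℝ).smulRight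
                (EuclideanSpace.proj x : EuclideanSpace ℝ ι →L[ℝ] ℝ))) -
              (∑ p ∈ C, ∑ x ∈ cell p, (w' x (ω x + ψ₀ x)) • (EuclideanSpace.proj x : EuclideanSpace ℝ ι →L[ℝ] ℝ)).smulRight
                (∑ p ∈ C, ∑ x ∈ cell p, (w' x (ω x + ψ₀ x)) • (EuclideanSpace.proj x : EuclideanSpace ℝ ι →L[ℝ] ℝ)))
            ∂(multivariateGaussian 0 M⁻¹)) +
        (((∫ ω : EuclideanSpace ℝ ι, exp (-(∑ p ∈ C, ∑ x ∈ cell p, w x (ω x + ψ₀ x))) ∂(multivariateGaussian 0 M⁻¹)) ^ 2)⁻¹ •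
          ∫ ω : EuclideanSpace ℝ ι, exp (-(∑ p ∈ C, ∑ x ∈ cell p, w x (ω x + ψ₀ x))) •
            (∑ p ∈ C, ∑ x ∈ cell p, (w' x (ω x + ψ₀ x)) • (EuclideanSpace.proj x : EuclideanSpace ℝ ι →L[ℝ] ℝ))
            ∂(multivariateGaussian 0 M⁻¹)).smulRight
          (∫ ω : EuclideanSpace ℝ ι, exp (-(∑ p ∈ C, ∑ x ∈ cell p, w x (ω x + ψ₀ x))) •
            (∑ p ∈ C, ∑ x ∈ cell p, (w' x (ω x + ψ₀ x)) • (EuclideanSpace.proj x : EuclideanSpace ℝ ι →L[ℝ] ℝ))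
            ∂(multivariateGaussian 0 M⁻¹)))
          (EuclideanSpace.single x (1 : ℝ)) (EuclideanSpace.single y (1 : ℝ)) +
        ((∫ ω : EuclideanSpace ℝ ι, exp (-(∑ p ∈ C, ∑ x ∈ cell p, w x (ω x + ψ₀ x))) ∂(multivariateGaussian 0 M⁻¹))⁻¹ •
          (∫ ω : EuclideanSpace ℝ ι, exp (-(∑ p ∈ C, ∑ x ∈ cell p, w x (ω x + ψ₀ x))) •
            ((∑ p ∈ C, ∑ x ∈ cell p, (w'' x (ω x + ψ₀ x)) • ((EuclideanSpace.proj x : EuclideanSpace ℝ ι →L[ℝ] ℝ).smulRight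
                (EuclideanSpace.proj x : EuclideanSpace ℝ ι →L[ℝ] ℝ))) -
              (∑ p ∈ C, ∑ x ∈ cell p, (w' x (ω x + ψ₀ x)) • (EuclideanSpace.proj x : EuclideanSpace ℝ ι →L[ℝ] ℝ)).smulRight
                (∑ p ∈ C, ∑ x ∈ cell p, (w' x (ω x + ψ₀ x)) • (EuclideanSpace.proj x : EuclideanSpace ℝ ι →L[ℝ] ℝ)))
            ∂(multivariateGaussian 0 M⁻¹)) +
        (((∫ ω : EuclideanSpace ℝ ι, exp (-(∑ p ∈ C, ∑ x ∈ cell p, w x (ω x + ψ₀ x))) ∂(multivariateGaussian 0 M⁻¹)) ^ 2)⁻¹ •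
          ∫ ω : EuclideanSpace ℝ ι, exp (-(∑ p ∈ C, ∑ x ∈ cell p, w x (ω x + ψ₀ x))) •
            (∑ p ∈ C, ∑ x ∈ cell p, (w' x (ω x + ψ₀ x)) • (EuclideanSpace.proj x : EuclideanSpace ℝ ι →L[ℝ] ℝ))
            ∂(multivariateGaussian 0 M⁻¹)).smulRight
          (∫ ω : EuclideanSpace ℝ ι, exp (-(∑ p ∈ C, ∑ x ∈ cell p, w x (ω x + ψ₀ x))) •
            (∑ p ∈ C, ∑ x ∈ cell p, (w' x (ω x + ψ₀ x)) • (EuclideanSpace.proj x : EuclideanSpace ℝ ι →L[ℝ] ℝ))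
            ∂(multivariateGaussian 0 M⁻¹)))
          (EuclideanSpace.single y (1 : ℝ)) (EuclideanSpace.single x (1 : ℝ))) / 2)) *ᵥ (WithLp.ofLp (ζ' - ζ)))) ≤
        (Λw + 2 * lamw) / 2 * (∑ x ∈ C.biUnion cell, (ζ' x - ζ x) ^ 2) := by
  obtain ⟨hup, hlo⟩ := neg_log_two_sided_at hM hfl hΓop hdisj hw' hw'm hκ₀ hκ₁ hτ hδ hθ0 hθ1 hκθ hκθ₆ hstab hquad hw'b hlamw hwlo hwup hm
    C ψ₀ ζ ζ'
  -- the matrix letters on the increment `ζ′ − ζ`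
  obtain ⟨q1, q2⟩ := quadratic_part_two_sided hM hfl hΓop hdisj hw' hw'' hw'm hw''m hκ₀ hκ₁ hτ hδ hθ0 hθ1 hκθ hκθ₆ hstab hquad hw'b hw''b
    hlamw hwlo hwup hm C ψ₀ (ζ' - ζ)
  -- symmetry of `K_D` and the quadratic increment
  set L : EuclideanSpace ℝ ι →L[ℝ] EuclideanSpace ℝ ι →L[ℝ] ℝ :=
    ((∫ ω : EuclideanSpace ℝ ι, exp (-(∑ p ∈ C, ∑ x ∈ cell p, w x (ω x + ψ₀ x))) ∂(multivariateGaussian 0 M⁻¹))⁻¹ •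
          (∫ ω : EuclideanSpace ℝ ι, exp (-(∑ p ∈ C, ∑ x ∈ cell p, w x (ω x + ψ₀ x))) •
            ((∑ p ∈ C, ∑ x ∈ cell p, (w'' x (ω x + ψ₀ x)) • ((EuclideanSpace.proj x : EuclideanSpace ℝ ι →L[ℝ] ℝ).smulRight
                (EuclideanSpace.proj x : EuclideanSpace ℝ ι →L[ℝ] ℝ))) -
              (∑ p ∈ C, ∑ x ∈ cell p, (w' x (ω x + ψ₀ x)) • (EuclideanSpace.proj x : EuclideanSpace ℝ ι →L[ℝ] ℝ)).smulRight
                (∑ p ∈ C, ∑ x ∈ cell p, (w' x (ω x + ψ₀ x)) • (EuclideanSpace.proj x : EuclideanSpace ℝ ι →L[ℝ] ℝ)))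
            ∂(multivariateGaussian 0 M⁻¹)) +
        (((∫ ω : EuclideanSpace ℝ ι, exp (-(∑ p ∈ C, ∑ x ∈ cell p, w x (ω x + ψ₀ x))) ∂(multivariateGaussian 0 M⁻¹)) ^ 2)⁻¹ •
          ∫ ω : EuclideanSpace ℝ ι, exp (-(∑ p ∈ C, ∑ x ∈ cell p, w x (ω x + ψ₀ x))) •
            (∑ p ∈ C, ∑ x ∈ cell p, (w' x (ω x + ψ₀ x)) • (EuclideanSpace.proj x : EuclideanSpace ℝ ι →L[ℝ] ℝ))
            ∂(multivariateGaussian 0 M⁻¹)).smulRight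
          (∫ ω : EuclideanSpace ℝ ι, exp (-(∑ p ∈ C, ∑ x ∈ cell p, w x (ω x + ψ₀ x))) •
            (∑ p ∈ C, ∑ x ∈ cell p, (w' x (ω x + ψ₀ x)) • (EuclideanSpace.proj x : EuclideanSpace ℝ ι →L[ℝ] ℝ))
            ∂(multivariateGaussian 0 M⁻¹))) with hL
  have hinc := quadratic_increment
    (symmMatrix_isHermitian (fun x y : ι => L (EuclideanSpace.single x (1 : ℝ)) (EuclideanSpace.single y (1 : ℝ))))
    (WithLp.ofLp ζ) (WithLp.ofLp ζ')
  simp only [WithLp.ofLp_sub, Pi.sub_apply] at q1 q2 hinc ⊢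
  constructor
  · linarith [hup, hlo, q1, q2, hinc]
  · linarith [hup, hlo, q1, q2, hinc]

end Road

/-! ## §3. Toy -/

/-- Toy (§1): for `K = 1` the quadratic increment is `|z′−z|²`. -/
example (z z' : ι → ℝ) : z' ⬝ᵥ (1 : Matrix ι ι ℝ) *ᵥ z' - z ⬝ᵥ (1 : Matrix ι ι ℝ) *ᵥ z - 2 * (z ⬝ᵥ (1 : Matrix ι ι ℝ) *ᵥ (z' - z)) =
    (z' - z) ⬝ᵥ (1 : Matrix ι ι ℝ) *ᵥ (z' - z) :=
  quadratic_increment Matrix.isHermitian_one z z'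

end Summit.QuantumFields.BalabanUV.T4Continuum.NE7b.SupResidualSecondOrderClass
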